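import Summits.BirchSwinnertonDyer.BirchSwinnertonDyer.Theorems.ByReductionTypeAtTwoSupersingularFlatKummerRepresentative
import Literature.NumberTheory.EllipticCurves.Sprung2012.LocalIwasawaModule
import Literature.NumberTheory.GaloisRepresentations.AbsGaloisGroupCompact
import HarnessLib

/-!
# Route `ByReductionTypeAtTwo` (rung K4), crux `SupersingularRankZeroAtTwo` (item stmt-BirchSwinnertonDyer-19097), stub 5
# `stub_flatKernelCyclic` (hand h13), sub-hand h13b, brick (K4/K5-Galois): **CONJUGATION OF KUMMER DATA and the KEYING
# `γ` versus `g`** — (i) the Kummer data of `conj_{res δ} c` is `(φ^δ, δ • Q, k)`; (ii) `Γ_K = res(Γ_{K_v}) · ker κ` from the single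
# hypothesis `κ(res g) = 1` (compactness of `Γ_{K_v}` + density of `ℕ` in `ℤ_p`); (iii) on the layer `E(K_n·K_v)` every local `δ`
# acts as a NATURAL power `g^m` (`m = κ(res δ) mod pⁿ`); (iv) `z(g^m • y) = (E^m • z)(y)` for `(1+T)E = 1` in `Λ`
# (cell `bsd-2adic`, seat `bsd-2adic-t42` GEN 45; `--supports 19097`, helper; sequel of `…FlatKummerRepresentative` (K2))

HONEST FRAMING (D-0036/D-0054): THEOREMS ONLY (no definition, no named fact, no `sorry`, no instance); generic field `K`, prime `p`,
`ℤ_p`-extension `κ`, place `ι : K̄ → K̄_E`, curve `W`, local element `g`.  These are the Galois-side inputs of the Kummer injection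
`j : Sel_∞ ⧸ Sel♭ ↪ Λ^∨` (memo `t42/gen44/FLAT-KERNEL-CYCLIC-GEN44.md` §2): (i) feeds the equivariance K4 and the `⨅_σ` collapse of
K5, (ii) is the collapse itself (every `σ ∈ Γ_K` is a local element modulo `ker κ`, so the ♭-condition «at `ι` and all its
conjugates» is the condition at `ι`), (iii)+(iv) replace the `p`-adic power `(1+T)^{κ(res δ)}` by an honest natural power on each
layer.  No `p`-adic binomial series is used.  19097 OPEN; nothing booked; BSD proved for no curve.

* §1 `exists_conjH1_kummerData` — `conj_{res δ}` of a class with Kummer data `(φ, Q, k)` at `ι` has Kummer data `(φ^δ, δ • Q, k)`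
  (`map_oneCocycleClass` for the compatible pair `(h ↦ σ⁻¹hσ, σ • ·)`, `pointsMapOfEmb_smul`).
* §2 `exists_toAdd_apply_resGalOfEmb_eq` / `exists_eq_resGalOfEmb_mul_of_isTopGenerator` — `κ ∘ res_ι : Γ_{K_v} → ℤ_p` is ONTO when
  `κ(res g) = 1`; hence `σ = res(δ) · h`, `h ∈ ker κ`, for every `σ ∈ Γ_K`; `conjH1_eq_conjH1_resGalOfEmb` (`conj_σ = conj_{res δ}` on
  `H¹(K_∞, E[p^∞])`), `conjH1_eq_of_isTopGenerator` (`conj_γ = conj_{res g}` when `κ γ = κ(res g) = 1`).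
* §3 `exists_smul_eq_pow_smul_of_mem_layer` — `δ • x = g^m • x` for `x ∈ E(K_n·K_v)`.
* §4 `apply_smul_point_eq_smul_apply`, `apply_pow_smul_point_eq_pow_smul_apply` — `z(g • y) = (E • z)(y)`, `z(g^m • y) = (E^m • z)(y)`
  for the action `Sprung2012.moduleOfGenerator … hg` and any `E ∈ Λ` with `(1+T)E = 1`.

References: [SerreLocalFields1979] VII §5 (conjugation on cochains); [NeukirchSchmidtWingberg2008] I §5; [Washington1997] §13.1–13.2
(`ℤ_p`-extensions, `γ ↦ 1+T`); [Sprung2012] §2 p. 1486, Def. 3.1, Lemma 7.10, Def. 7.11; tree `SubgroupSelmer`, `ContinuousH1`,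
`Sprung2012/LocalIwasawaModule`, `Kobayashi2003/SignedSelmer`, p824988.
-/

set_option autoImplicit false
-- the Theorems namespace of this sub repeats the summit name by design (D-0017 nested layout)
set_option linter.dupNamespace false

noncomputable section

open scoped Classical

universe u

namespace Summit.BirchSwinnertonDyer.BirchSwinnertonDyer.Theorems

namespace OddBlindNF

open WeierstrassCurve Literature.NumberTheory.EllipticCurves Literature.NumberTheory.EllipticCurves.Sprung2012
  Literature.NumberTheory.EllipticCurves.Sprung2017 Literature.NumberTheory.EllipticCurves.Kobayashi2003
  Literature.NumberTheory.GaloisRepresentations ZpExtension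

variable {K : Type u} [Field K] {p : ℕ} [hp : Fact p.Prime] {κ : ZpExtension K p}
variable {E : Type u} [Field E] [Algebra K E] {ι : AlgebraicClosure K →ₐ[K] AlgebraicClosure E} {W : WeierstrassCurve K}

/-! ### §1 Conjugation of Kummer data by a local element -/

/-- **Kummer data of a conjugate class.**  If `c ∈ H¹(K_∞, E[p^∞])` has Kummer data `(φ, Q, k)` at `ι` (`[φ] = c`, `p^kQ ∈ E(K_∞·K_v)`,
`φ|_{Gal(K̄_v/K_∞·K_v)} = τ ↦ τQ − Q`), then for every `δ ∈ Γ_{K_v}` the class `conj_{res δ} c` has Kummer data `(φ^δ, δ • Q, k)`,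
`φ^δ(h) = (res δ) φ((res δ)⁻¹ h (res δ))`. [cite: SerreLocalFields1979, VII §5 Prop. 3 (conjugation on cochains)]
[cite: Kobayashi2003, §2 p. 4 (the Kummer map)] -/
theorem exists_conjH1_kummerData (δ : Field.absoluteGaloisGroup E)
    {φ : contOneCocycles.{0, u} (discreteTopRep κ.kerSubgroup (W.geomPrimaryTorsion p))} {Q : localPoints W E} {k : ℕ}
    (hQ : (p ^ k) • Q ∈ localTowerPointsOfEmb κ ι W)
    (hτ : ∀ τ : localSubgroupOfEmb κ.kerSubgroup ι,
      pointsMapOfEmb W ι ((φ.1 (resGalSubgroupOfEmb κ.kerSubgroup ι τ) : W.geomPrimaryTorsion p) : W.geomPoints) =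
        (τ : Field.absoluteGaloisGroup E) • Q - Q) :
    ∃ φ' : contOneCocycles.{0, u} (discreteTopRep κ.kerSubgroup (W.geomPrimaryTorsion p)),
      oneCocycleClass (discreteTopRep κ.kerSubgroup (W.geomPrimaryTorsion p)) φ' =
        W.conjH1 p κ.kerSubgroup (resGalOfEmb ι δ) (oneCocycleClass (discreteTopRep κ.kerSubgroup (W.geomPrimaryTorsion p)) φ) ∧
      (p ^ k) • (δ • Q) ∈ localTowerPointsOfEmb κ ι W ∧
      ∀ τ : localSubgroupOfEmb κ.kerSubgroup ι,
        pointsMapOfEmb W ι ((φ'.1 (resGalSubgroupOfEmb κ.kerSubgroup ι τ) : W.geomPrimaryTorsion p) : W.geomPoints) =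
          (τ : Field.absoluteGaloisGroup E) • (δ • Q) - δ • Q := by
  set σ : Field.absoluteGaloisGroup K := resGalOfEmb ι δ with hσ
  have hc : ∀ (x : κ.kerSubgroup) (m : W.geomPrimaryTorsion p),
      DistribSMul.toAddMonoidHom (W.geomPrimaryTorsion p) σ (subgroupConj κ.kerSubgroup σ x • m) =
        x • DistribSMul.toAddMonoidHom (W.geomPrimaryTorsion p) σ m := fun x m ↦ by
    simp only [DistribSMul.toAddMonoidHom_apply, Subgroup.smul_def, subgroupConj_apply_coe, smul_smul, mul_assoc,
      mul_inv_cancel_left]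
  refine ⟨contOneCocycles.pullback (subgroupConj κ.kerSubgroup σ)
    (resHomOfEquivariant (subgroupConj κ.kerSubgroup σ) (DistribSMul.toAddMonoidHom (W.geomPrimaryTorsion p) σ) hc) φ,
    (map_oneCocycleClass (discreteTopRep κ.kerSubgroup (W.geomPrimaryTorsion p)) (subgroupConj κ.kerSubgroup σ) _ φ).symm,
    ?_, fun τ ↦ ?_⟩
  · rw [smul_comm]
    exact smul_mem_localTowerPointsOfEmb κ ι W δ hQ
  · -- the conjugated local element `δ⁻¹ τ δ`
    have hmem : δ⁻¹ * (τ : Field.absoluteGaloisGroup E) * δ ∈ localSubgroupOfEmb κ.kerSubgroup ι := by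
      rw [mem_localSubgroupOfEmb_iff, map_mul, map_mul, map_inv]
      exact κ.kerSubgroup_normal.conj_mem' _ ((mem_localSubgroupOfEmb_iff _ _ _).mp τ.2) _
    have hconj : subgroupConj κ.kerSubgroup σ (resGalSubgroupOfEmb κ.kerSubgroup ι τ) =
        resGalSubgroupOfEmb κ.kerSubgroup ι ⟨_, hmem⟩ := Subtype.ext (by
      simp only [subgroupConj_apply_coe, resGalSubgroupOfEmb_apply_coe, hσ, map_mul, map_inv])
    rw [contOneCocycles.pullback_apply]
    change pointsMapOfEmb W ι (((σ • φ.1 (subgroupConj κ.kerSubgroup σ (resGalSubgroupOfEmb κ.kerSubgroup ι τ)) :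
      W.geomPrimaryTorsion p) : W.geomPoints)) = _
    rw [hconj, Literature.NumberTheory.EllipticCurves.primaryComponent.coe_smul, hσ, pointsMapOfEmb_smul, hτ ⟨_, hmem⟩,
      smul_sub, ← mul_smul, ← mul_smul,
      show δ * (δ⁻¹ * (τ : Field.absoluteGaloisGroup E) * δ) = (τ : Field.absoluteGaloisGroup E) * δ by group]

/-! ### §2 `Γ_K = res(Γ_{K_v}) · ker κ` from `κ(res g) = 1` -/

variable {g : Field.absoluteGaloisGroup E}

/-- **`κ ∘ res_ι` is onto `ℤ_p`** when `κ(res g) = 1`: its image is compact (`Γ_{K_v}` compact, `κ`, `res` continuous), hence closed,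
and contains `ℕ · 1` (the powers of `g`), which is dense in `ℤ_p`. [cite: Washington1997, §13.1 (ℤ_p-extensions)] -/
theorem exists_toAdd_apply_resGalOfEmb_eq (hg : κ.IsTopGenerator (resGalOfEmb ι g)) (a : ℤ_[p]) :
    ∃ δ : Field.absoluteGaloisGroup E, (κ (resGalOfEmb ι δ)).toAdd = a := by
  haveI := absoluteGaloisGroup_compactSpace E
  let F : Field.absoluteGaloisGroup E → ℤ_[p] := fun δ ↦ (κ (resGalOfEmb ι δ)).toAdd
  have hF : Continuous F :=
    continuous_toAdd.comp ((map_continuous κ).comp (map_continuous (resGalOfEmb ι)))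
  have hclosed : IsClosed (Set.range F) := (isCompact_range hF).isClosed
  have hnat : Set.range (Nat.cast : ℕ → ℤ_[p]) ⊆ Set.range F := by
    rintro _ ⟨m, rfl⟩
    refine ⟨g ^ m, ?_⟩
    show (κ (resGalOfEmb ι (g ^ m))).toAdd = (m : ℤ_[p])
    rw [map_pow, map_pow, hg, toAdd_pow, toAdd_ofAdd, nsmul_eq_mul, mul_one]
  have ha : a ∈ closure (Set.range F) :=
    closure_mono hnat (by rw [PadicInt.denseRange_natCast.closure_range]; exact Set.mem_univ a)
  rw [hclosed.closure_eq] at ha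
  exact ha

/-- **`Γ_K = res(Γ_{K_v}) · ker κ`**: every `σ ∈ Γ_K` is `res(δ) · h` with `δ ∈ Γ_{K_v}` and `h ∈ Gal(K̄/K_∞)` (the place of `K_∞`
singled out by `ι` is the ONLY one over `v`: its decomposition group maps onto `Gal(K_∞/K)`). [cite: Washington1997, §13.1 (ℤ_p-extensions)] -/
theorem exists_eq_resGalOfEmb_mul_of_isTopGenerator (hg : κ.IsTopGenerator (resGalOfEmb ι g)) (σ : Field.absoluteGaloisGroup K) :
    ∃ (δ : Field.absoluteGaloisGroup E) (h : Field.absoluteGaloisGroup K), h ∈ κ.kerSubgroup ∧ σ = resGalOfEmb ι δ * h := by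
  obtain ⟨δ, hδ⟩ := exists_toAdd_apply_resGalOfEmb_eq hg (κ σ).toAdd
  refine ⟨δ, (resGalOfEmb ι δ)⁻¹ * σ, ?_, by rw [mul_inv_cancel_left]⟩
  rw [mem_kerSubgroup, map_mul, map_inv, ← toAdd_eq_zero, toAdd_mul, toAdd_inv, hδ, neg_add_cancel]

/-- **`conj_σ = conj_{res δ}` on `H¹(K_∞, E[p^∞])`** for `σ = res(δ) · h`, `h ∈ ker κ` (inner automorphisms act trivially,
`conjH1_of_mem_holds`). [cite: SerreLocalFields1979, VII §5 Prop. 3] -/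
theorem conjH1_eq_conjH1_resGalOfEmb {σ : Field.absoluteGaloisGroup K} {δ : Field.absoluteGaloisGroup E}
    {h : Field.absoluteGaloisGroup K} (hh : h ∈ κ.kerSubgroup) (hσ : σ = resGalOfEmb ι δ * h) :
    W.conjH1 p κ.kerSubgroup σ = W.conjH1 p κ.kerSubgroup (resGalOfEmb ι δ) := by
  rw [hσ, W.conjH1_mul_holds p κ.kerSubgroup, W.conjH1_of_mem_holds p κ.kerSubgroup hh, AddMonoidHom.comp_id]

/-- **KEYING: `conj_γ = conj_{res g}` on `H¹(K_∞, E[p^∞])`** when `γ` and `res g` are both the normalised topological generator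
(`κ γ = κ(res g) = 1`, the tree's `ZpExtension.IsTopGenerator`): `γ ∈ (res g) · ker κ` exactly. [cite: Washington1997, §13.2 (γ ↦ 1+T)] -/
theorem conjH1_eq_of_isTopGenerator {γ : Field.absoluteGaloisGroup K} (hγ : κ.IsTopGenerator γ)
    (hg : κ.IsTopGenerator (resGalOfEmb ι g)) :
    W.conjH1 p κ.kerSubgroup γ = W.conjH1 p κ.kerSubgroup (resGalOfEmb ι g) := by
  refine conjH1_eq_conjH1_resGalOfEmb (h := (resGalOfEmb ι g)⁻¹ * γ) ?_ (by rw [mul_inv_cancel_left])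
  rw [mem_kerSubgroup, map_mul, map_inv]
  rw [ZpExtension.IsTopGenerator] at hγ hg
  rw [hγ, hg, inv_mul_cancel]

/-! ### §3 On a layer every local element is a natural power of `g` -/

/-- **`δ • x = g^m • x` on `E(K_n·K_v)`** with `m = κ(res δ) mod pⁿ`: `g^{-m} δ` lies in `Gal(K̄_v/K_n·K_v)` (`pⁿ ∣ κ(res(g^{-m}δ))`),
which fixes the layer pointwise. [cite: Kobayashi2003, Def. 1.1] [cite: Washington1997, §13.1] -/
theorem exists_smul_eq_pow_smul_of_mem_layer (hg : κ.IsTopGenerator (resGalOfEmb ι g)) (δ : Field.absoluteGaloisGroup E)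
    {n : ℕ} {x : localPoints W E} (hx : x ∈ localLayerPointsOfEmb κ ι W n) :
    ∃ m : ℕ, δ • x = g ^ m • x := by
  set a : ℤ_[p] := (κ (resGalOfEmb ι δ)).toAdd with ha
  refine ⟨(PadicInt.toZModPow n a).val, ?_⟩
  set m : ℕ := (PadicInt.toZModPow n a).val with hm
  -- `τ := g^{-m} δ` fixes the layer
  have hτ : (g ^ m)⁻¹ * δ ∈ localLayerSubgroupOfEmb κ ι n := by
    rw [mem_localLayerSubgroupOfEmb_iff, map_mul, map_inv, map_pow, map_mul, map_inv, map_pow, hg, toAdd_mul, toAdd_inv,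
      toAdd_pow, toAdd_ofAdd, nsmul_eq_mul, mul_one, ← ha, neg_add_eq_sub, ← Ideal.mem_span_singleton, ← PadicInt.ker_toZModPow,
      RingHom.mem_ker, map_sub, map_natCast, hm, ZMod.natCast_zmod_val, sub_self]
  have hfix := (mem_localLayerPointsOfEmb_iff κ ι W n x).mp hx _ hτ
  calc δ • x = (g ^ m * ((g ^ m)⁻¹ * δ)) • x := by rw [mul_inv_cancel_left]
    _ = g ^ m • x := by rw [mul_smul, hfix]

/-! ### §4 Translating the point by `g` is acting by `(1+T)⁻¹` on the functional -/

/-- **`z(g • y) = (E • z)(y)`** for every functional `z` on `E(K_∞·K_v)`, every tower point `y` and every `E ∈ Λ` with `(1+T) E = 1`,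
for the action `moduleOfGenerator … hg` (`((1+T) • w)(y') = w(g⁻¹ y')`, `lambdaSMul_X_apply`). [cite: Sprung2012, §2 p. 1486 and Def. 3.1 (p. 1489)] -/
theorem apply_smul_point_eq_smul_apply (hg : κ.IsTopGenerator (resGalOfEmb ι g)) {Einv : PowerSeries ℤ_[p]}
    (hE : (1 + PowerSeries.X) * Einv = 1) (z : localTowerPointsOfEmb κ ι W →+ ℤ_[p]) (y : localTowerPointsOfEmb κ ι W) :
    z ⟨g • (y : localPoints W E), smul_mem_localTowerPointsOfEmb κ ι W g y.2⟩ =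
      (letI := moduleOfGenerator κ ι W hg; (Einv • z) y) := by
  letI := moduleOfGenerator κ ι W hg
  set y' : localTowerPointsOfEmb κ ι W := ⟨g • (y : localPoints W E), smul_mem_localTowerPointsOfEmb κ ι W g y.2⟩ with hy'
  have h1 : ((1 + PowerSeries.X : PowerSeries ℤ_[p]) • (Einv • z)) y' = z y' := by rw [← mul_smul, hE, one_smul]
  have hy : (⟨g⁻¹ • (y' : localPoints W E), smul_mem_localTowerPointsOfEmb κ ι W g⁻¹ y'.2⟩ : localTowerPointsOfEmb κ ι W) = y :=
    Subtype.ext (by show g⁻¹ • (g • (y : localPoints W E)) = y; exact inv_smul_smul g (y : localPoints W E))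
  rw [add_smul, one_smul, AddMonoidHom.add_apply, moduleOfGenerator_smul_eq hg PowerSeries.X, lambdaSMul_X_apply, hy,
    add_sub_cancel] at h1
  exact h1.symm

/-- **`z(g^m • y) = (E^m • z)(y)`** (iterate of the previous lemma). [cite: Sprung2012, §2 p. 1486 and Def. 3.1 (p. 1489)] -/
theorem apply_pow_smul_point_eq_pow_smul_apply (hg : κ.IsTopGenerator (resGalOfEmb ι g)) {Einv : PowerSeries ℤ_[p]}
    (hE : (1 + PowerSeries.X) * Einv = 1) (z : localTowerPointsOfEmb κ ι W →+ ℤ_[p]) (m : ℕ) (y : localTowerPointsOfEmb κ ι W) :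
    z ⟨g ^ m • (y : localPoints W E), smul_mem_localTowerPointsOfEmb κ ι W (g ^ m) y.2⟩ =
      (letI := moduleOfGenerator κ ι W hg; (Einv ^ m • z) y) := by
  letI := moduleOfGenerator κ ι W hg
  induction m generalizing z with
  | zero =>
    have hy : (⟨g ^ 0 • (y : localPoints W E), smul_mem_localTowerPointsOfEmb κ ι W (g ^ 0) y.2⟩ : localTowerPointsOfEmb κ ι W) = y :=
      Subtype.ext (by show g ^ 0 • (y : localPoints W E) = y; rw [pow_zero, one_smul])
    rw [hy, pow_zero, one_smul]
  | succ m ih =>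
    have hy : (⟨g ^ (m + 1) • (y : localPoints W E), smul_mem_localTowerPointsOfEmb κ ι W (g ^ (m + 1)) y.2⟩ :
        localTowerPointsOfEmb κ ι W) =
        ⟨g • ((⟨g ^ m • (y : localPoints W E), smul_mem_localTowerPointsOfEmb κ ι W (g ^ m) y.2⟩ :
          localTowerPointsOfEmb κ ι W) : localPoints W E), smul_mem_localTowerPointsOfEmb κ ι W g
            (smul_mem_localTowerPointsOfEmb κ ι W (g ^ m) y.2)⟩ :=
      Subtype.ext (by show g ^ (m + 1) • (y : localPoints W E) = g • (g ^ m • (y : localPoints W E)); rw [pow_succ', mul_smul])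
    rw [hy, apply_smul_point_eq_smul_apply hg hE, ih (Einv • z), ← mul_smul, ← pow_succ]

end OddBlindNF

end Summit.BirchSwinnertonDyer.BirchSwinnertonDyer.Theorems

end
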